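import Literature.NumberTheory.EllipticCurves.TwistDuplicationDenominatorProofs
import Literature.NumberTheory.EllipticCurves.SigmaSqInvXDuplicationProofs
import Literature.NumberTheory.EllipticCurves.SigmaSqDivisionOfThetaProofs
import HarnessLib

/-!
# The duplication law `h(2P) = 4h(P)` of the minus-twist receptacle `canonicalPAdicHeightSqMinusTwist`,
# `x`-only (proofs only)

Topic `Literature/NumberTheory/EllipticCurves` (trunk T-NT-EC). Pure proof file (no definition, no named
fact), sequel of `SigmaSqInvXDuplicationProofs.lean` (sigma half: `w³𝔖(ρ(w)) = 𝔖(w)⁴N(w)`) and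
`TwistDuplicationDenominatorProofs.lean` (denominator half). Width seat `bsd-line-cf2-p1-w5` (g20) of the
cell `bsd-print-cf2`, in support of stmt-BirchSwinnertonDyer-20368 (road (C); the `d = ±2` boundary of
the pinning stub `stub_pin_minusTwist_two`). BSD is not proved by any of this.

* §1 `padicSigmaSqInvXEval_duplication` — **the values of `𝔖_p = padicSigmaSqInvX V p` duplicate**:
  `w³·𝔖_p(w N(w)/M(w)) = 𝔖_p(w)⁴·N(w)` for `‖w‖_p < 1` (evaluation of `invXExpansion_duplication` on the
  pair's squared `2`-division identity `sigmaSqDivisionIdentity_sq_of_satisfiesSigmaODE`);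
* §2 `xDouble_mul_ΨSq₂_eq` (`x(2P)ψ₂²(x) = Φ₂(x)`, any curve over `ℚ`), `minusTwistX_two_smul`
  (**`x(2P)/d = Φ₂(x′)/ψ₂²(x′)` on `V^{(d)}`, `x′ = x(P)/d`**);
* §3 `canonicalPAdicHeightSqMinusTwist_two_smul` — **`h(2P) = 4·h(P)` for the receptacle
  `h = canonicalPAdicHeightSqMinusTwist V 2 d`** on every point of the receptacle's local-conditions locus
  (`‖x′‖₂ > 4` + the odd-prime conditions), `d ∈ {−1, 2, −2}`, WITHOUT any `ℚ₂`-formal group containing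
  the point — the one identity the boundary `ord₂ x′ = −3` of `d = ±2` needs.

Sources: [MazurSteinTate2006] §1 eq. (1.1); [Silverman2005DivPoly] §5 Thm. 11 (18), Rem. 2; [MazurTate1991]
Thm. 3.1; [SilvermanAEC2009] III.2.3(d), Exercise 3.7(d).
-/

noncomputable section

open scoped Classical
open PowerSeries Literature.NumberTheory.EllipticCurves

namespace WeierstrassCurve

/-! ### §1 The values of `𝔖_p` duplicate -/

section Plumbing

variable {p : ℕ} [Fact p.Prime]

/-- `N(w) = 4 + b₂w + 2b₄w² + b₆w³` evaluates as written (private plumbing). [folklore] -/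
private theorem padicEval_cubicN {b₂ b₄ b₆ : ℚ_[p]} (h₂ : ‖b₂‖ ≤ 1) (h₄ : ‖b₄‖ ≤ 1) (h₆ : ‖b₆‖ ≤ 1)
    {w : ℚ_[p]} (hw : ‖w‖ < 1) :
    IsPadicInt (PowerSeries.C 4 + PowerSeries.C b₂ * PowerSeries.X + PowerSeries.C (2 * b₄) * PowerSeries.X ^ 2 +
      PowerSeries.C b₆ * PowerSeries.X ^ 3 : ℚ_[p]⟦X⟧) ∧
    padicEval (PowerSeries.C 4 + PowerSeries.C b₂ * PowerSeries.X + PowerSeries.C (2 * b₄) * PowerSeries.X ^ 2 +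
      PowerSeries.C b₆ * PowerSeries.X ^ 3) w = 4 + b₂ * w + 2 * b₄ * w ^ 2 + b₆ * w ^ 3 := by
  have h4i : ‖(4 : ℚ_[p])‖ ≤ 1 := by exact_mod_cast Padic.norm_int_le_one (p := p) 4
  have h2i : ‖(2 : ℚ_[p])‖ ≤ 1 := by exact_mod_cast Padic.norm_int_le_one (p := p) 2
  have h2b₄ : ‖(2 * b₄)‖ ≤ 1 := by rw [norm_mul]; exact mul_le_one₀ h2i (norm_nonneg _) h₄
  have hXi : IsPadicInt (PowerSeries.X : ℚ_[p]⟦X⟧) := IsPadicInt.powerSeries_X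
  have e1 : IsPadicInt (PowerSeries.C (4 : ℚ_[p])) := IsPadicInt.powerSeries_C h4i
  have e2 : IsPadicInt (PowerSeries.C b₂ * PowerSeries.X) := (IsPadicInt.powerSeries_C h₂).mul hXi
  have e3 : IsPadicInt (PowerSeries.C (2 * b₄) * PowerSeries.X ^ 2) :=
    (IsPadicInt.powerSeries_C h2b₄).mul (hXi.pow 2)
  have e4 : IsPadicInt (PowerSeries.C b₆ * PowerSeries.X ^ 3) := (IsPadicInt.powerSeries_C h₆).mul (hXi.pow 3)
  refine ⟨((e1.add e2).add e3).add e4, ?_⟩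
  rw [padicEval_add ((e1.add e2).add e3) e4 hw, padicEval_add (e1.add e2) e3 hw, padicEval_add e1 e2 hw,
    padicEval_mul (IsPadicInt.powerSeries_C h₂) hXi hw, padicEval_mul (IsPadicInt.powerSeries_C h2b₄) (hXi.pow 2) hw,
    padicEval_mul (IsPadicInt.powerSeries_C h₆) (hXi.pow 3) hw, padicEval_pow hXi hw, padicEval_pow hXi hw,
    padicEval_C, padicEval_C, padicEval_C, padicEval_C, padicEval_X]

/-- `M(w) = 1 − b₄w² − 2b₆w³ − b₈w⁴` evaluates as written (private plumbing). [folklore] -/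
private theorem padicEval_quarticM {b₄ b₆ b₈ : ℚ_[p]} (h₄ : ‖b₄‖ ≤ 1) (h₆ : ‖b₆‖ ≤ 1) (h₈ : ‖b₈‖ ≤ 1)
    {w : ℚ_[p]} (hw : ‖w‖ < 1) :
    IsPadicInt (1 - PowerSeries.C b₄ * PowerSeries.X ^ 2 - PowerSeries.C (2 * b₆) * PowerSeries.X ^ 3 -
      PowerSeries.C b₈ * PowerSeries.X ^ 4 : ℚ_[p]⟦X⟧) ∧
    padicEval (1 - PowerSeries.C b₄ * PowerSeries.X ^ 2 - PowerSeries.C (2 * b₆) * PowerSeries.X ^ 3 -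
      PowerSeries.C b₈ * PowerSeries.X ^ 4) w = 1 - b₄ * w ^ 2 - 2 * b₆ * w ^ 3 - b₈ * w ^ 4 := by
  have h2i : ‖(2 : ℚ_[p])‖ ≤ 1 := by exact_mod_cast Padic.norm_int_le_one (p := p) 2
  have h2b₆ : ‖(2 * b₆)‖ ≤ 1 := by rw [norm_mul]; exact mul_le_one₀ h2i (norm_nonneg _) h₆
  have hXi : IsPadicInt (PowerSeries.X : ℚ_[p]⟦X⟧) := IsPadicInt.powerSeries_X
  have e2 : IsPadicInt (PowerSeries.C b₄ * PowerSeries.X ^ 2) := (IsPadicInt.powerSeries_C h₄).mul (hXi.pow 2)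
  have e3 : IsPadicInt (PowerSeries.C (2 * b₆) * PowerSeries.X ^ 3) :=
    (IsPadicInt.powerSeries_C h2b₆).mul (hXi.pow 3)
  have e4 : IsPadicInt (PowerSeries.C b₈ * PowerSeries.X ^ 4) := (IsPadicInt.powerSeries_C h₈).mul (hXi.pow 4)
  refine ⟨((IsPadicInt.one.sub e2).sub e3).sub e4, ?_⟩
  rw [padicEval_sub ((IsPadicInt.one.sub e2).sub e3) e4 hw, padicEval_sub (IsPadicInt.one.sub e2) e3 hw,
    padicEval_sub IsPadicInt.one e2 hw, padicEval_mul (IsPadicInt.powerSeries_C h₄) (hXi.pow 2) hw,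
    padicEval_mul (IsPadicInt.powerSeries_C h2b₆) (hXi.pow 3) hw,
    padicEval_mul (IsPadicInt.powerSeries_C h₈) (hXi.pow 4) hw, padicEval_pow hXi hw, padicEval_pow hXi hw,
    padicEval_pow hXi hw, padicEval_C, padicEval_C, padicEval_C, padicEval_one, padicEval_X]

/-- The `b`-invariants of a `p`-integral equation are `p`-adic integers (private plumbing). [folklore] -/
private theorem norm_b_le_one_padic (V₂ : WeierstrassCurve ℚ_[p]) [V₂.IsIntegral ℤ_[p]] :
    ‖V₂.b₂‖ ≤ 1 ∧ ‖V₂.b₄‖ ≤ 1 ∧ ‖V₂.b₆‖ ≤ 1 ∧ ‖V₂.b₈‖ ≤ 1 := by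
  have h := V₂.eq_map_integralModel
  refine ⟨?_, ?_, ?_, ?_⟩
  · rw [← h, map_b₂]; exact PadicInt.norm_le_one _
  · rw [← h, map_b₄]; exact PadicInt.norm_le_one _
  · rw [← h, map_b₆]; exact PadicInt.norm_le_one _
  · rw [← h, map_b₈]; exact PadicInt.norm_le_one _

/-- `M⁻¹ ∈ ℤ_p⟦w⟧` (private plumbing). [folklore] -/
private theorem isPadicInt_invOfUnit_quarticM (V₂ : WeierstrassCurve ℚ_[p]) [V₂.IsIntegral ℤ_[p]] :
    IsPadicInt (invOfUnit (1 - PowerSeries.C V₂.b₄ * PowerSeries.X ^ 2 -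
      PowerSeries.C (2 * V₂.b₆) * PowerSeries.X ^ 3 - PowerSeries.C V₂.b₈ * PowerSeries.X ^ 4 : ℚ_[p]⟦X⟧) 1) := by
  rw [isPadicInt_iff_exists_powerSeries_map]
  set V₀ := V₂.integralModel ℤ_[p]
  have hg : constantCoeff (1 - PowerSeries.C V₀.b₄ * PowerSeries.X ^ 2 -
      PowerSeries.C (2 * V₀.b₆) * PowerSeries.X ^ 3 - PowerSeries.C V₀.b₈ * PowerSeries.X ^ 4 : ℤ_[p]⟦X⟧) = 1 := by
    simp
  refine ⟨invOfUnit (1 - PowerSeries.C V₀.b₄ * PowerSeries.X ^ 2 -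
      PowerSeries.C (2 * V₀.b₆) * PowerSeries.X ^ 3 - PowerSeries.C V₀.b₈ * PowerSeries.X ^ 4) 1, ?_⟩
  rw [Literature.NumberTheory.EllipticCurves.map_invOfUnit_one _ _ hg]
  congr 1
  simp only [map_sub, map_one, map_mul, PowerSeries.map_C, PowerSeries.map_X, map_pow, map_ofNat]
  rw [← V₂.eq_map_integralModel, map_b₄, map_b₆, map_b₈]

/-- `𝔖(t) ≠ 0` for `0 < ‖t‖ < 1` and an integral `S = w + O(w²)` (private plumbing). [folklore] -/
private theorem padicEval_ne_zero_of_normalised {S : ℚ_[p]⟦X⟧} (hS : IsPadicInt S)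
    (hS0 : constantCoeff S = 0) (hS1 : coeff 1 S = 1) {t : ℚ_[p]} (ht0 : t ≠ 0) (ht : ‖t‖ < 1) :
    padicEval S t ≠ 0 := by
  have hS1' : IsPadicInt (sigmaShift S) := by
    rw [isPadicInt_iff_coeff] at hS ⊢; intro n; rw [coeff_sigmaShift]; exact hS _
  have h1 : constantCoeff (sigmaShift S) = 1 := by rw [constantCoeff_sigmaShift, hS1]
  have hne : padicEval (sigmaShift S) t ≠ 0 := by
    intro h0
    have := norm_padicEval_sub_constantCoeff_le hS1' ht
    rw [h0, h1, zero_sub, norm_neg, norm_one] at this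
    exact not_le.mpr ht this
  rw [← X_mul_sigmaShift hS0, padicEval_mul IsPadicInt.powerSeries_X hS1' ht, padicEval_X]
  exact mul_ne_zero ht0 hne

end Plumbing

section Values

variable (V : WeierstrassCurve ℚ) [V.IsElliptic] [V.IsIntegral ℤ] (p : ℕ) [Fact p.Prime]

/-- **The squared duplication formula for the VALUES of `𝔖_p = padicSigmaSqInvX V p`** (`V/ℚ` elliptic,
`ℤ`-integral, with a sigma-squared pair at `p`): for `‖w‖_p < 1`,
`M(w) = 1 − b₄w² − 2b₆w³ − b₈w⁴ ≠ 0` and **`w³·𝔖_p(w·N(w)/M(w)) = 𝔖_p(w)⁴·N(w)`**,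
`N(w) = 4 + b₂w + 2b₄w² + b₆w³` — evaluation of `invXExpansion_duplication` (the pair's squared `2`-division
identity `sigmaSqDivisionIdentity_sq_of_satisfiesSigmaODE` in the variable `w = 1/x`).
[Silverman 2005, §5 Thm. 11 (18) and Rem. 2; Mazur–Tate 1991, Thm. 3.1]
[cite: Silverman2005DivPoly, §5 Thm. 11 (18) and Rem. 2] [cite: MazurTate1991, Thm. 3.1] -/
theorem padicSigmaSqInvXEval_duplication
    (hex : ∃ Sq : ℚ_[p]⟦X⟧, ∃ c : ℚ_[p], (V.baseChange ℚ_[p]).IsMazurTateSigmaSqPair Sq c)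
    {w : ℚ_[p]} (hw : ‖w‖ < 1) :
    (1 - (V.b₄ : ℚ_[p]) * w ^ 2 - 2 * V.b₆ * w ^ 3 - V.b₈ * w ^ 4) ≠ 0 ∧
    w ^ 3 * V.padicSigmaSqInvXEval p (w * (4 + V.b₂ * w + 2 * V.b₄ * w ^ 2 + V.b₆ * w ^ 3) /
        (1 - V.b₄ * w ^ 2 - 2 * V.b₆ * w ^ 3 - V.b₈ * w ^ 4)) =
      V.padicSigmaSqInvXEval p w ^ 4 * (4 + V.b₂ * w + 2 * V.b₄ * w ^ 2 + V.b₆ * w ^ 3) := by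
  unfold padicSigmaSqInvXEval
  set V₂ := V.baseChange ℚ_[p] with hV₂
  set S := V.padicSigmaSqInvX p with hSdef
  have eb₂ : (V.b₂ : ℚ_[p]) = V₂.b₂ := by simp [hV₂, baseChange]
  have eb₄ : (V.b₄ : ℚ_[p]) = V₂.b₄ := by simp [hV₂, baseChange]
  have eb₆ : (V.b₆ : ℚ_[p]) = V₂.b₆ := by simp [hV₂, baseChange]
  have eb₈ : (V.b₈ : ℚ_[p]) = V₂.b₈ := by simp [hV₂, baseChange]
  rw [eb₂, eb₄, eb₆, eb₈]
  have hpair := isMazurTateSigmaSqPair_padicSigmaSq (W := V₂) (Or.inr hex)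
  have hS : V₂.IsInvXExpansion V₂.padicSigmaSq S := isInvXExpansion_padicSigmaSqInvX_of_exists_pair (Or.inr hex)
  have hSint : IsPadicInt S := hS.isPadicInt hpair.isPadicInt
  -- the squared 2-division identity of the pair, in the `x⁻¹`-variable
  obtain ⟨σ₁, h10, h11, hodd, hODE, hSq⟩ := hpair.exists_sq_eq
  have hdiv : V₂.SigmaSqDivisionIdentity V₂.padicSigmaSq 2 := by
    rw [hSq]; exact sigmaSqDivisionIdentity_sq_of_satisfiesSigmaODE h10 h11 hodd hODE (by norm_num)
  have key := invXExpansion_duplication hS hdiv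
  -- integrality and values of `N`, `M`, `M⁻¹`
  obtain ⟨h₂, h₄, h₆, h₈⟩ := norm_b_le_one_padic V₂
  obtain ⟨hNi, hNval⟩ := padicEval_cubicN h₂ h₄ h₆ hw
  obtain ⟨hMi, hMval⟩ := padicEval_quarticM h₄ h₆ h₈ hw
  have hMii := isPadicInt_invOfUnit_quarticM V₂
  have hXi : IsPadicInt (PowerSeries.X : ℚ_[p]⟦X⟧) := IsPadicInt.powerSeries_X
  have hMX1 : constantCoeff (1 - PowerSeries.C V₂.b₄ * PowerSeries.X ^ 2 -
      PowerSeries.C (2 * V₂.b₆) * PowerSeries.X ^ 3 - PowerSeries.C V₂.b₈ * PowerSeries.X ^ 4 : ℚ_[p]⟦X⟧) = 1 := by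
    simp
  have hMinv := mul_invOfUnit _ 1 (by rw [hMX1, Units.val_one])
  have hMinvval : padicEval (1 - PowerSeries.C V₂.b₄ * PowerSeries.X ^ 2 -
      PowerSeries.C (2 * V₂.b₆) * PowerSeries.X ^ 3 - PowerSeries.C V₂.b₈ * PowerSeries.X ^ 4 : ℚ_[p]⟦X⟧) w *
      padicEval (invOfUnit (1 - PowerSeries.C V₂.b₄ * PowerSeries.X ^ 2 -
        PowerSeries.C (2 * V₂.b₆) * PowerSeries.X ^ 3 - PowerSeries.C V₂.b₈ * PowerSeries.X ^ 4 : ℚ_[p]⟦X⟧) 1) w = 1 := by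
    rw [← padicEval_mul hMi hMii hw, hMinv, padicEval_one]
  rw [hMval] at hMinvval
  have hM0 : (1 - V₂.b₄ * w ^ 2 - 2 * V₂.b₆ * w ^ 3 - V₂.b₈ * w ^ 4) ≠ 0 := fun h => by
    rw [h, zero_mul] at hMinvval; exact zero_ne_one hMinvval
  refine ⟨hM0, ?_⟩
  -- evaluate `key` at `w`
  have hρi := (hXi.mul hNi).mul hMii
  have hρ0 : constantCoeff (PowerSeries.X * (PowerSeries.C 4 + PowerSeries.C V₂.b₂ * PowerSeries.X +
      PowerSeries.C (2 * V₂.b₄) * PowerSeries.X ^ 2 + PowerSeries.C V₂.b₆ * PowerSeries.X ^ 3) *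
      invOfUnit (1 - PowerSeries.C V₂.b₄ * PowerSeries.X ^ 2 - PowerSeries.C (2 * V₂.b₆) * PowerSeries.X ^ 3 -
        PowerSeries.C V₂.b₈ * PowerSeries.X ^ 4) 1 : ℚ_[p]⟦X⟧) = 0 := by simp
  have hev := congrArg (fun F => padicEval F w) key
  rw [padicEval_mul (hXi.pow 3) (hSint.powerSeries_subst hρi (HasSubst.of_constantCoeff_zero' hρ0)) hw,
    padicEval_pow hXi hw, padicEval_X, padicEval_subst hSint hρi hρ0 hw,
    padicEval_mul (hXi.mul hNi) hMii hw, padicEval_mul hXi hNi hw, padicEval_X, hNval,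
    padicEval_mul (hSint.pow 4) hNi hw, padicEval_pow hSint hw, hNval] at hev
  rw [div_eq_mul_inv, ← eq_inv_of_mul_eq_one_right hMinvval]
  exact hev

end Values

/-! ### §2 `x(2P)` on the twist: `x′(2P) = Φ₂(x′)/ψ₂²(x′)` -/

section Twist

/-- **`x(2P)·ψ₂²(x(P)) = Φ₂(x(P))` and `ψ₂²(x(P)) ≠ 0`** for `2P = (X₂, Y₂) ≠ O` on any Weierstrass curve
over `ℚ` (the tree's `mul_eval_ΨSq_of_zsmul_eq`, `zsmul_some_eq_zero_iff_eval_ΨSq`, with the division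
polynomials written out). [Silverman AEC III.2.3(d), Exercise 3.7(d)] [cite: SilvermanAEC2009, Exercise 3.7(d)] -/
theorem xDouble_mul_ΨSq₂_eq (T : WeierstrassCurve ℚ) {X Y : ℚ} (h : T.toAffine.Nonsingular X Y)
    {X₂ Y₂ : ℚ} (h₂ : T.toAffine.Nonsingular X₂ Y₂)
    (h2 : (2 : ℕ) • (.some X Y h : T.toAffine.Point) = .some X₂ Y₂ h₂) :
    (4 * X ^ 3 + T.b₂ * X ^ 2 + 2 * T.b₄ * X + T.b₆) ≠ 0 ∧
      X₂ * (4 * X ^ 3 + T.b₂ * X ^ 2 + 2 * T.b₄ * X + T.b₆) = X ^ 4 - T.b₄ * X ^ 2 - 2 * T.b₆ * X - T.b₈ := by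
  have h2Z : ((2 : ℕ) : ℤ) • (.some X Y h : T.toAffine.Point) = .some X₂ Y₂ h₂ := by
    rw [natCast_zsmul]; exact h2
  have h2' := (point_zsmul_irrel (instDecidableEqRat) (fun a b => Classical.propDecidable (a = b))
    ((2 : ℕ) : ℤ) (.some X Y h : T.toAffine.Point)).symm.trans h2Z
  have hmul := mul_eval_ΨSq_of_zsmul_eq (W := T) h ((2 : ℕ) : ℤ) h₂ h2'
  have hne : (T.ΨSq ((2 : ℕ) : ℤ)).eval X ≠ 0 := fun h0 => by
    have := (zsmul_some_eq_zero_iff_eval_ΨSq (W := T) h ((2 : ℕ) : ℤ)).mpr h0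
    rw [h2'] at this
    exact Affine.Point.some_ne_zero _ this
  have hΨ : (T.ΨSq ((2 : ℕ) : ℤ)).eval X = 4 * X ^ 3 + T.b₂ * X ^ 2 + 2 * T.b₄ * X + T.b₆ := by
    rw [Nat.cast_ofNat, WeierstrassCurve.ΨSq_two, WeierstrassCurve.Ψ₂Sq]
    simp only [Polynomial.eval_add, Polynomial.eval_mul, Polynomial.eval_C, Polynomial.eval_pow, Polynomial.eval_X]
  have hΦ : (T.Φ ((2 : ℕ) : ℤ)).eval X = X ^ 4 - T.b₄ * X ^ 2 - 2 * T.b₆ * X - T.b₈ := by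
    rw [Nat.cast_ofNat, WeierstrassCurve.Φ_two]
    simp only [Polynomial.eval_sub, Polynomial.eval_mul, Polynomial.eval_C, Polynomial.eval_pow, Polynomial.eval_X]
  rw [hΨ] at hne hmul
  rw [hΦ] at hmul
  exact ⟨hne, hmul⟩

variable (V : WeierstrassCurve ℚ) (d : ℚ)

/-- **`x(2P)/d = Φ₂(x′)/ψ₂²(x′)` on the twist `V^{(d)}`, `x′ = x(P)/d`** (the division polynomials of
the twist model are `ψ₂²_{V^{(d)}}(dx′) = d³ψ₂²(x′)`, `Φ₂,_{V^{(d)}}(dx′) = d⁴Φ₂(x′)`), together with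
`ψ₂²(x′) ≠ 0` when `2P ≠ O`. [Silverman AEC III.2.3(d), Exercise 3.7(d); Rubin–Silverberg 2002 §1]
[cite: SilvermanAEC2009, Exercise 3.7(d)] -/
theorem minusTwistX_two_smul (hd : d ≠ 0) {X Y : ℚ} (h : (V.quadraticTwist d).toAffine.Nonsingular X Y)
    {X₂ Y₂ : ℚ} (h₂ : (V.quadraticTwist d).toAffine.Nonsingular X₂ Y₂)
    (h2 : (2 : ℕ) • (.some X Y h : (V.quadraticTwist d).toAffine.Point) = .some X₂ Y₂ h₂) :
    (4 * (X / d) ^ 3 + V.b₂ * (X / d) ^ 2 + 2 * V.b₄ * (X / d) + V.b₆) ≠ 0 ∧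
      X₂ / d = ((X / d) ^ 4 - V.b₄ * (X / d) ^ 2 - 2 * V.b₆ * (X / d) - V.b₈) /
        (4 * (X / d) ^ 3 + V.b₂ * (X / d) ^ 2 + 2 * V.b₄ * (X / d) + V.b₆) := by
  obtain ⟨hne, hmul⟩ := xDouble_mul_ΨSq₂_eq (V.quadraticTwist d) h h₂ h2
  rw [quadraticTwist_b₂, quadraticTwist_b₄, quadraticTwist_b₆] at hne hmul
  rw [quadraticTwist_b₈] at hmul
  have hΨ : (4 * X ^ 3 + d * V.b₂ * X ^ 2 + 2 * (d ^ 2 * V.b₄) * X + d ^ 3 * V.b₆) =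
      d ^ 3 * (4 * (X / d) ^ 3 + V.b₂ * (X / d) ^ 2 + 2 * V.b₄ * (X / d) + V.b₆) := by
    field_simp
  have hΦ : (X ^ 4 - d ^ 2 * V.b₄ * X ^ 2 - 2 * (d ^ 3 * V.b₆) * X - d ^ 4 * V.b₈) =
      d ^ 4 * ((X / d) ^ 4 - V.b₄ * (X / d) ^ 2 - 2 * V.b₆ * (X / d) - V.b₈) := by
    field_simp
  rw [hΨ] at hne hmul
  rw [hΦ] at hmul
  have hB : (4 * (X / d) ^ 3 + V.b₂ * (X / d) ^ 2 + 2 * V.b₄ * (X / d) + V.b₆) ≠ 0 :=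
    fun h0 => hne (by rw [h0, mul_zero])
  refine ⟨hB, ?_⟩
  rw [eq_div_iff hB, div_mul_eq_mul_div, div_eq_iff hd]
  have hd3 : d ^ 3 ≠ 0 := pow_ne_zero 3 hd
  apply mul_left_cancel₀ hd3
  linear_combination hmul

end Twist

/-! ### §3 The duplication law `h(2P) = 4h(P)` of the receptacle -/

section Duplication

variable (V : WeierstrassCurve ℚ) [V.IsElliptic] [V.IsIntegral ℤ] (d : ℤ)

/-- **Duplication law of the minus-twist receptacle, `x`-only.** For `V/ℚ` elliptic `ℤ`-integral with a
sigma-squared pair at `2`, `d ∈ {−1, 2, −2}`, and a point `P = (X, Y) ∈ V^{(d)}(ℚ)` with `x′ = X/d` of size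
`‖x′‖₂ > 4` (the receptacle's disc condition) satisfying the receptacle's odd-prime conditions, if
`2P = (X₂, Y₂)` then `h(2P) = 4·h(P)` for `h = canonicalPAdicHeightSqMinusTwist V 2 d`:
`log₂ den x′(2P) = 4 log₂ den x′ + log₂ ψ₂²(x′)` (`padicLog_den_xDouble`) and
`log₂ 𝔖₂(1/x′(2P)) = 4 log₂ 𝔖₂(1/x′) + log₂ ψ₂²(x′)` (`padicSigmaSqInvXEval_duplication` at `w = 1/x′`,
`x′(2P) = Φ₂(x′)/ψ₂²(x′)`). No `ℚ₂`-formal group containing `P` is used — the point of the exercise at the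
boundary `ord₂ x′ = −3` of `d = ±2`. [Mazur–Stein–Tate 2006, §1 eq. (1.1) («h_p(nQ) = n²h_p(Q)»);
Silverman 2005, §5 Thm. 11 (18), Rem. 2] [cite: MazurSteinTate2006, §1] [cite: Silverman2005DivPoly, §5 Rem. 2] -/
theorem canonicalPAdicHeightSqMinusTwist_two_smul (hd : d = -1 ∨ d = 2 ∨ d = -2)
    (hex : ∃ Sq : ℚ_[2]⟦X⟧, ∃ c : ℚ_[2], (V.baseChange ℚ_[2]).IsMazurTateSigmaSqPair Sq c)
    {X Y : ℚ} (h : (V.quadraticTwist (d : ℚ)).toAffine.Nonsingular X Y)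
    (hx : 4 < ‖((X / (d : ℚ) : ℚ) : ℚ_[2])‖)
    (hmin : ∀ ℓ : ℕ, ℓ.Prime → ℓ ≠ 2 → V.HasNonsingularMinusReductionAt (d : ℚ) ℓ (X / (d : ℚ)))
    {X₂ Y₂ : ℚ} (h₂ : (V.quadraticTwist (d : ℚ)).toAffine.Nonsingular X₂ Y₂)
    (h2 : (2 : ℕ) • (.some X Y h : (V.quadraticTwist (d : ℚ)).toAffine.Point) = .some X₂ Y₂ h₂) :
    V.canonicalPAdicHeightSqMinusTwist 2 (d : ℚ) (.some X₂ Y₂ h₂) =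
      4 * V.canonicalPAdicHeightSqMinusTwist 2 (d : ℚ) (.some X Y h) := by
  have hmul : padicLog_mul 2 := padicLog_mul_holds 2
  have hd0 : (d : ℚ) ≠ 0 := by rcases hd with rfl | rfl | rfl <;> norm_num
  set x' : ℚ := X / (d : ℚ) with hx'
  set A : ℚ := x' ^ 4 - V.b₄ * x' ^ 2 - 2 * V.b₆ * x' - V.b₈ with hA
  set B : ℚ := 4 * x' ^ 3 + V.b₂ * x' ^ 2 + 2 * V.b₄ * x' + V.b₆ with hB
  obtain ⟨hB0, hx₂⟩ := V.minusTwistX_two_smul (d : ℚ) hd0 h h₂ h2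
  change B ≠ 0 at hB0
  change X₂ / (d : ℚ) = A / B at hx₂
  -- sizes at `2`
  have hx0 : (x' : ℚ_[2]) ≠ 0 := by
    intro h0; rw [h0, norm_zero] at hx; exact not_lt.mpr (by norm_num : (0 : ℝ) ≤ 4) hx
  have hx0' : x' ≠ 0 := by intro h0; apply hx0; rw [h0, Rat.cast_zero]
  set w : ℚ_[2] := (x' : ℚ_[2])⁻¹ with hwdef
  have hw0 : w ≠ 0 := inv_ne_zero hx0
  have hw : ‖w‖ < 1 := by
    rw [hwdef, norm_inv]; exact inv_lt_one_of_one_lt₀ (lt_trans (by norm_num) hx)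
  -- the sigma side
  obtain ⟨hM0, hdup⟩ := V.padicSigmaSqInvXEval_duplication 2 hex hw
  set S := V.padicSigmaSqInvX 2 with hSdef
  have hpairV := isMazurTateSigmaSqPair_padicSigmaSq (W := V.baseChange ℚ_[2]) (Or.inr hex)
  have hSexp := isInvXExpansion_padicSigmaSqInvX_of_exists_pair (V := V) (p := 2) (Or.inr hex)
  have hSint : IsPadicInt S := hSexp.isPadicInt hpairV.isPadicInt
  have hS0 : constantCoeff S = 0 := hSexp.constantCoeff_eq hpairV.constantCoeff_eq
  have hS1 : coeff 1 S = 1 := hSexp.coeff_one_eq hpairV.constantCoeff_eq hpairV.coeff_two_eq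
  -- `N(w) = B·w³`, `M(w) = A·w⁴`, `ρ(w) = B/A = 1/x′(2P)`
  have hN : (4 + (V.b₂ : ℚ_[2]) * w + 2 * V.b₄ * w ^ 2 + V.b₆ * w ^ 3) = (B : ℚ_[2]) * w ^ 3 := by
    rw [hB]; push_cast; rw [hwdef]; field_simp
  have hM : (1 - (V.b₄ : ℚ_[2]) * w ^ 2 - 2 * V.b₆ * w ^ 3 - V.b₈ * w ^ 4) = (A : ℚ_[2]) * w ^ 4 := by
    rw [hA]; push_cast; rw [hwdef]; field_simp
  have hA0 : (A : ℚ_[2]) ≠ 0 := by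
    intro h0; rw [hM, h0, zero_mul] at hM0; exact hM0 rfl
  have hB0' : (B : ℚ_[2]) ≠ 0 := by exact_mod_cast hB0
  have hρ : w * (4 + (V.b₂ : ℚ_[2]) * w + 2 * V.b₄ * w ^ 2 + V.b₆ * w ^ 3) /
      (1 - V.b₄ * w ^ 2 - 2 * V.b₆ * w ^ 3 - V.b₈ * w ^ 4) = (((A / B : ℚ)) : ℚ_[2])⁻¹ := by
    rw [hN, hM]; push_cast; field_simp
  rw [hρ, hN] at hdup
  -- logarithms of the sigma values
  have hSw : V.padicSigmaSqInvXEval 2 w ≠ 0 := padicEval_ne_zero_of_normalised hSint hS0 hS1 hw0 hw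
  have hρ0 : (((A / B : ℚ)) : ℚ_[2])⁻¹ ≠ 0 := inv_ne_zero (by push_cast; exact div_ne_zero hA0 hB0')
  have hρn : ‖(((A / B : ℚ)) : ℚ_[2])⁻¹‖ < 1 := by
    have : (((A / B : ℚ)) : ℚ_[2])⁻¹ = w * ((B : ℚ_[2]) * w ^ 3) / ((A : ℚ_[2]) * w ^ 4) := by
      rw [← hN, ← hM, hρ]
    rw [this, hwdef]
    have hxn : 1 < ‖(x' : ℚ_[2])‖ := lt_trans (by norm_num) hx
    -- `‖A‖ = ‖x′‖⁴` and `‖B‖ ≤ ‖x′‖³` give `‖ρ‖ ≤ ‖x′‖⁻¹ < 1`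
    obtain ⟨V₀, hV₀⟩ := (inferInstance : V.IsIntegral ℤ).integral
    have hb : ∀ q : ℚ, (∃ z : ℤ, q = z) → ‖(q : ℚ_[2])‖ ≤ 1 := by
      rintro q ⟨z, rfl⟩; rw [Rat.cast_intCast]; exact Padic.norm_int_le_one z
    have h₂ : ‖(V.b₂ : ℚ_[2])‖ ≤ 1 := hb _ ⟨V₀.b₂, by rw [hV₀]; simp [baseChange]⟩
    have h₄ : ‖(V.b₄ : ℚ_[2])‖ ≤ 1 := hb _ ⟨V₀.b₄, by rw [hV₀]; simp [baseChange]⟩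
    have h₆ : ‖(V.b₆ : ℚ_[2])‖ ≤ 1 := hb _ ⟨V₀.b₆, by rw [hV₀]; simp [baseChange]⟩
    have h₈ : ‖(V.b₈ : ℚ_[2])‖ ≤ 1 := hb _ ⟨V₀.b₈, by rw [hV₀]; simp [baseChange]⟩
    set u := ‖(x' : ℚ_[2])‖ with hu
    have hu0 : 0 < u := one_pos.trans hxn
    have h2le : ‖(2 : ℚ_[2])‖ ≤ 1 := by exact_mod_cast Padic.norm_int_le_one (p := 2) 2
    have h4le : ‖(4 : ℚ_[2])‖ ≤ 1 := by exact_mod_cast Padic.norm_int_le_one (p := 2) 4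
    have htailA : ‖((V.b₄ : ℚ_[2]) * (x' : ℚ_[2]) ^ 2 + 2 * V.b₆ * x' + V.b₈)‖ ≤ u ^ 2 := by
      refine (Padic.nonarchimedean _ _).trans (max_le ((Padic.nonarchimedean _ _).trans (max_le ?_ ?_)) ?_)
      · rw [norm_mul, norm_pow]; exact mul_le_of_le_one_left (pow_nonneg hu0.le 2) h₄
      · rw [norm_mul, norm_mul]
        calc ‖(2 : ℚ_[2])‖ * ‖(V.b₆ : ℚ_[2])‖ * u ≤ 1 * 1 * u := by gcongr
          _ ≤ u ^ 2 := by rw [one_mul, one_mul, sq]; exact le_mul_of_one_le_left hu0.le hxn.le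
      · exact h₈.trans (one_le_pow₀ hxn.le)
    have hAn : ‖(A : ℚ_[2])‖ = u ^ 4 := by
      have hlead : ‖(x' : ℚ_[2]) ^ 4‖ = u ^ 4 := by rw [norm_pow]
      have hlt : u ^ 2 < u ^ 4 := pow_lt_pow_right₀ hxn (by norm_num)
      have hne : ‖(x' : ℚ_[2]) ^ 4‖ ≠ ‖-((V.b₄ : ℚ_[2]) * (x' : ℚ_[2]) ^ 2 + 2 * V.b₆ * x' + V.b₈)‖ := by
        rw [hlead, norm_neg]; exact ne_of_gt (htailA.trans_lt hlt)
      have := Padic.add_eq_max_of_ne hne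
      rw [hlead, norm_neg, max_eq_left (htailA.trans hlt.le)] at this
      rw [hA]; push_cast
      rw [show ((x' : ℚ_[2]) ^ 4 - V.b₄ * x' ^ 2 - 2 * V.b₆ * x' - V.b₈) =
        (x' : ℚ_[2]) ^ 4 + -((V.b₄ : ℚ_[2]) * (x' : ℚ_[2]) ^ 2 + 2 * V.b₆ * x' + V.b₈) by ring]
      exact this
    have hBn : ‖(B : ℚ_[2])‖ ≤ u ^ 3 := by
      rw [hB]; push_cast
      refine (Padic.nonarchimedean _ _).trans (max_le ((Padic.nonarchimedean _ _).trans
        (max_le ((Padic.nonarchimedean _ _).trans (max_le ?_ ?_)) ?_)) ?_)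
      · rw [norm_mul, norm_pow]; exact mul_le_of_le_one_left (pow_nonneg hu0.le 3) h4le
      · rw [norm_mul, norm_pow]
        calc ‖(V.b₂ : ℚ_[2])‖ * u ^ 2 ≤ 1 * u ^ 2 := by gcongr
          _ ≤ u ^ 3 := by rw [one_mul]; exact pow_le_pow_right₀ hxn.le (by norm_num)
      · rw [norm_mul, norm_mul]
        calc ‖(2 : ℚ_[2])‖ * ‖(V.b₄ : ℚ_[2])‖ * u ≤ 1 * 1 * u := by gcongr
          _ ≤ u ^ 3 := by rw [one_mul, one_mul]; exact le_self_pow₀ hxn.le (by norm_num)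
      · exact h₆.trans (one_le_pow₀ hxn.le)
    rw [norm_div, norm_mul, norm_mul, norm_mul, norm_pow, norm_pow, norm_inv, hAn, ← hu]
    rw [div_lt_one (by positivity)]
    calc u⁻¹ * (‖(B : ℚ_[2])‖ * u⁻¹ ^ 3) ≤ u⁻¹ * (u ^ 3 * u⁻¹ ^ 3) := by gcongr
      _ = u⁻¹ := by field_simp
      _ < 1 := inv_lt_one_of_one_lt₀ hxn
      _ = u ^ 4 * u⁻¹ ^ 4 := by field_simp
  have hSρ : V.padicSigmaSqInvXEval 2 (((A / B : ℚ)) : ℚ_[2])⁻¹ ≠ 0 :=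
    padicEval_ne_zero_of_normalised hSint hS0 hS1 hρ0 hρn
  have hlogσ : padicLog 2 (V.padicSigmaSqInvXEval 2 (((A / B : ℚ)) : ℚ_[2])⁻¹) =
      4 * padicLog 2 (V.padicSigmaSqInvXEval 2 w) + padicLog 2 (B : ℚ_[2]) := by
    have e := congrArg (padicLog 2) hdup
    rw [hmul (pow_ne_zero 3 hw0) hSρ, hmul (pow_ne_zero 4 hSw) (mul_ne_zero hB0' (pow_ne_zero 3 hw0)),
      hmul hB0' (pow_ne_zero 3 hw0),
      show (V.padicSigmaSqInvXEval 2 w) ^ 4 = ((V.padicSigmaSqInvXEval 2 w) ^ 2) ^ 2 by ring,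
      padicLog_sq (pow_ne_zero 2 hSw), padicLog_sq hSw] at e
    linear_combination e
  -- the denominator side
  have hlogd := V.padicLog_den_xDouble hmin hB0
  change padicLog 2 ((((A / B : ℚ)).den : ℚ) : ℚ_[2]) =
    4 * padicLog 2 ((x'.den : ℚ) : ℚ_[2]) + padicLog 2 ((B : ℚ) : ℚ_[2]) at hlogd
  -- assemble
  rw [canonicalPAdicHeightSqMinusTwist_some, canonicalPAdicHeightSqMinusTwist_some, hx₂, ← hx', hlogd, hlogσ,
    hwdef]
  ring

end Duplication

end WeierstrassCurve
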